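import Summits.QuantumFields.YangMills.Theorems.BalabanUVNodesN19TubeDecayDirectionPairs

/-!
# BalabanUVNodes ∕ N19 — THE BUNDLE DECAY LETTER `hdecT` OF THE N19′ FACE FROM STUB 1's BILL ROWS UNDER THE (t-U3) PIN:
# `hs ∕ hL ∕ h9` + W1's windowed (5.10) letter at every direction pair (or its `(0,1)`, `(0,0)` components + Euclidean covariance); any `γ ≤ θ.γ`

Cell `pub-ymgap`, HUMAN RULING D-0062 (Track A) ∕ D-0149 ∕ D-0154 (director-ym R399 (3a), №207 width wave), width seat `pub-ymgap-dag-n19-w5`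
(harness re-seat g1 of generation 0), FILE 6.  THEOREMS ONLY (0 `def`, 0 `instance`, 0 `sorry`); imports this seat's FILE 4 `BalabanUVNodesN19TubeDecayDirectionPairs`
ONLY; modifies nothing; `--kind proof --supports` K3⁷ `SpineGivenEndpointR13SepCoPH` (stmt-QuantumFields-20544) `--as helper` — COUNT-NEUTRAL.

WHY.  dag-n19-w3 g3's INTENT-8 (8a) `…N19RateEdgeHolderD4AtLedgerReading` (p613740) ∕ (8b) `…N19KeyedCoreEdgeHolderD4LedgerK3V5` move the tube block (T) of the N19′ link
reading OUT of NODE O's ∃-binder into ONE uniform BUNDLE DECAY LETTER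
`hdecT : ∀ F θ hP, G θ → θ.Admissible F N → ∀ γ : ℝ, γ ≤ θ.γ → ∀ g₀ os k, ∃ E₀, 0 ≤ E₀ ∧ DecayBound (R…).u3.EA (Window γ) E₀ (R…).u3.κ`
(`R… := rateCarriersOfRecord₁₃CoPH 𝔯 F θ hP g₀ os k`; NO positivity on `γ` — for `γ ≤ 0` the window `]0, γ]^ℕ` is empty and the clause is vacuous), so that (8b)'s three theorems
are keyed on v5's `GuardedReadingN16` + `β ≤ 1` + K1⁷'s window `hβw` + node U3's uniform letters `hunif` + `hdecT` + NODE O's ledger world `hlinkLedger`.  FILE 5 of this seat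
(`…N19UniformLettersAtU3Pin`) supplies `hunif` under the (t-U3) pin from stub 1's bill row `hs : (ℓ F θ).Signs` alone; THIS FILE supplies `hdecT` VERBATIM under the same pin
from stub 1's bill rows `hs` (`0 ≤ C₉`, `0 ≤ ω < 1`), `hL : PolLimitsExistOfRecord₁₃`, `h9 : WindowedNE9OfRecord₁₃ … κ moduli` (⟹ N22's slot at the pinned bundle, dag-n22-w3's
`n22At_u3OfRecord₁₃_objectsOfRecord₁₃_of_windowed`) and W1's windowed (5.10) letter `WindowedDecayOfRecord₁₃ … μ ν κ` AT EVERY PAIR (the bill has the pair `(0, 1)`; FILE 4's count)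
— or its `(0, 1)`, `(0, 0)` components plus `B12Beta.PermCovariant` of the limiting kernels of record (FILE 4's two-component road).  So at v5's key the N19′ face's U3-side
hypotheses beyond the key (`hunif`, `hdecT`) BOTH reduce to rows stub 1's bill displays plus the 15 extra pairs (or `(0,0)` + covariance): a consumer of (8b)'s ★★★ sets
`hdecT := hdecT_of_u3Pinned_of_stub1Rows 𝔯 G ℓ hpinU3 hs hL h9 hWall` (`hpinU3` = the `U3PinnedKernels` conjunct of `GuardedReadingN16`, unfolded) and `hunif :=` FILE 5's
`hunif_of_u3Pinned_of_signs 𝔯 G ℓ hpinU3 hs`.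
* §1 at the pinned bundle, ANY `γ ≤ θ.γ` [bookkeeping]: `decayBound_atPin_anyWindow_of_kernelDecay_all_of_n22At` (case split: `0 < γ` ⇒ `0 < θ.γ` and FILE 3∕4; `γ ≤ 0` ⇒ the window
  is empty, `E₀ := 0`); `decayBound_atPin_anyWindow_of_windowed_all` (from `ℓ.Signs`, `PolLimitsExistOfRecord₁₃`, `WindowedNE9OfRecord₁₃`, `∀ μ ν, WindowedDecayOfRecord₁₃`);
  `decayBound_atPin_anyWindow_of_windowed_offDiag_diag_cov` (the two-component road).
* §2 under the per-tuple pin at the reading, the VERBATIM `hdecT` text (generic `N`, guard `G : ∀ {F}, Stage13HParams F N → Prop`; at `N = 2`,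
  `G θ := θ.ZhUnity F 2 ∧ θ.SlotsNondegenerate₁₃ F 2` it is (8b)'s) [bookkeeping]: ★★ `hdecT_of_u3Pinned_of_stub1Rows` · ★ `hdecT_of_u3Pinned_of_stub1Rows_cov` ·
  `kernelDecayOfRecord₁₃_all_of_hdecT_of_u3Pinned` (converse: `hdecT` at `γ := θ.γ` returns the (D4)-type letter at every pair and every guarded admissible tuple — FILE 2) ·
  ★ `hdecT_iff_kernelDecayOfRecord₁₃_all_of_u3Pinned` (under the pin and `hs ∕ hL ∕ h9`: `hdecT` ⟺ the (D4)-type letter `KernelDecayOfRecord₁₃ … μ ν (ℓ F θ).κ` ∀ μν per tuple).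

LOCATED (count-neutral; for the plan's v6 precut letter list, dag-n19-w3's (8b) consumers and dag-n27's item-level composites).  At v5's key the N19′ face of `stub_expansion13H` asks of
node U3 EXACTLY: stub 1's U3 letter rows (`Signs`, `PolLimitsExist`, `WindowedNE9`, windowed (5.10)) with the windowed (5.10) letter at ALL SIXTEEN direction pairs instead of `(0, 1)`
(or at `(0, 1)`, `(0, 0)` plus Euclidean covariance [I] (1.21) p. 264 ∕ (5.6) p. 292) — nothing else; the remainder of the face is NODE O's ledger world `hlinkLedger`, K1⁷'s window and the
N16 rows.  [I] = [Balaban1987RG1].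

HONEST FRAMING.  Case splits and rewriting over HYPOTHESIS shapes; ZERO estimate content; every row is a DISPLAYED HYPOTHESIS inhabited for no family today; nothing of Bałaban's asserted;
NE7 ∕ NE9 ∕ (5.10)-at-the-record NOT PRINTED as two-run statements for d = 4 and NOT proved; no stub closed; N19 ∕ N22 NOT discharged; K3⁷ OPEN, skeleton v5 UNTOUCHED; counts UNMOVED
(typed 28∕28 · discharged 5∕27 · A 5∕28).  One finite 𝕋⁴ at fixed ε — R4 closes the CONDITIONAL rung `BalabanLadder.UV` only; the Yang–Mills mass gap (Clay) is NOT proved by any of this.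
[bookkeeping] throughout.
-/

noncomputable section

namespace Summit.QuantumFields.YangMills.BalabanUVNodes.N19BundleDecayLetterFromStub1Rows

open Literature.MathematicalPhysics.QuantumFieldTheory.Balaban1983to89
open Literature.MathematicalPhysics.QuantumFieldTheory.Balaban1983to89.T4Continuum (T4Family ULoop)
open Literature.MathematicalPhysics.QuantumFieldTheory.Balaban1983to89.T4OutputRate (Window DecayBound)
open Literature.MathematicalPhysics.QuantumFieldTheory.Balaban1983to89.Node00 (Stage13Params Stage13HParams U3Letters₁₁ mergedTermFamilyMatT TβOfRecord₁₃ chiβOfRecord₁₃)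
open Literature.MathematicalPhysics.QuantumFieldTheory.Balaban1983to89.Node00.U3OfKernels (objectsOfRecord₁₃ kernelA KernelDecayOfRecord₁₃)
open Literature.MathematicalPhysics.QuantumFieldTheory.Balaban1983to89.Node00.U3KernelLetters (PolLimitsExistOfRecord₁₃ WindowedNE9OfRecord₁₃ WindowedDecayOfRecord₁₃)
open Literature.MathematicalPhysics.QuantumFieldTheory.Balaban1983to89.B12Beta (PermCovariant)
open YMDAG.UVSplit (RateReading₁₃CoPH N22At u3OfRecord₁₃ rateCarriersOfRecord₁₃CoPH)
open YMDAG.N22.AtKernels (n22At_u3OfRecord₁₃_objectsOfRecord₁₃_of_windowed kernelDecayOfRecord₁₃_of_windowed)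
open Summit.QuantumFields.YangMills.BalabanUVNodes.N19LinkReadingAtU3Pin (kernelDecayOfRecord₁₃_of_decayBound u3_rateCarriersOfRecord₁₃CoPH_of_pin)
open Summit.QuantumFields.YangMills.BalabanUVNodes.N19TubeDecayAtU3PinFromLetters (decayBound_atPin_tuningWindow)
open Summit.QuantumFields.YangMills.BalabanUVNodes.N19TubeDecayDirectionPairs (kernelDecayOfRecord₁₃_all_of_offDiag_diag kernelDecayOfRecord₁₃_all_of_windowed_all)

variable {N : ℕ} [NeZero N]

/-! ## §1 At the pinned bundle, any `γ ≤ θ.γ` -/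

section AtPin

open scoped Matrix.Norms.L2Operator

variable {F : T4Family} (θ : Stage13Params F N) (ℓ : U3Letters₁₁) (k : ℕ)

/-- **(T)'s DECAY ON `]0, γ]^ℕ` FOR ANY `γ ≤ θ.γ` FROM THE (D4)-TYPE LETTER AT EVERY PAIR AND N22's SLOT** [bookkeeping]: for `0 < γ` this is FILE 3's supplier on the tuning window
(then `0 < θ.γ`); for `γ ≤ 0` the window is EMPTY and `E₀ := 0` serves.  No positivity premise on `θ.γ`. [folklore] -/
theorem decayBound_atPin_anyWindow_of_kernelDecay_all_of_n22At (h : ∀ μ ν : Fin 4, KernelDecayOfRecord₁₃ F N θ μ ν ℓ.κ)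
    (h22 : N22At (u3OfRecord₁₃ θ (objectsOfRecord₁₃ F N θ ℓ) k)) (hC₉ : 0 ≤ ℓ.C₉) (hω0 : 0 ≤ ℓ.ω) (hω1 : ℓ.ω < 1) {γ : ℝ} (hγ : γ ≤ θ.γ) :
    ∃ E₀ : ℝ, 0 ≤ E₀ ∧ DecayBound (u3OfRecord₁₃ θ (objectsOfRecord₁₃ F N θ ℓ) k).EA (Window γ) E₀ ℓ.κ := by
  by_cases hγ0 : 0 < γ
  · exact decayBound_atPin_tuningWindow θ ℓ k h h22 hC₉ hω0 hω1 (lt_of_lt_of_le hγ0 hγ) hγ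
  · exact ⟨0, le_rfl, fun g hg _ _ => absurd (lt_of_lt_of_le (hg 0).1 (hg 0).2) hγ0⟩

/-- **THE SAME FROM STUB 1's LETTER ROWS, THE WINDOWED (5.10) LETTER AT EVERY PAIR** [bookkeeping]: `ℓ.Signs` (signs of `C₉, ω`), `PolLimitsExistOfRecord₁₃`,
`WindowedNE9OfRecord₁₃ … ℓ.κ ℓ.moduli` (⟹ N22's slot at the pinned bundle, dag-n22-w3) and `∀ μ ν, WindowedDecayOfRecord₁₃ … μ ν ℓ.κ` (⟹ the (D4)-type letter ∀μν, FILE 4). [folklore] -/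
theorem decayBound_atPin_anyWindow_of_windowed_all (hs : ℓ.Signs) (hL : PolLimitsExistOfRecord₁₃ F N θ) (h9 : WindowedNE9OfRecord₁₃ F N θ ℓ.κ ℓ.moduli)
    (hW : ∀ μ ν : Fin 4, WindowedDecayOfRecord₁₃ F N θ μ ν ℓ.κ) {γ : ℝ} (hγ : γ ≤ θ.γ) :
    ∃ E₀ : ℝ, 0 ≤ E₀ ∧ DecayBound (u3OfRecord₁₃ θ (objectsOfRecord₁₃ F N θ ℓ) k).EA (Window γ) E₀ ℓ.κ :=
  decayBound_atPin_anyWindow_of_kernelDecay_all_of_n22At θ ℓ k (kernelDecayOfRecord₁₃_all_of_windowed_all θ hL hW)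
    (n22At_u3OfRecord₁₃_objectsOfRecord₁₃_of_windowed F N θ ℓ hs k hL h9) hs.C₉_nonneg hs.ω_nonneg hs.ω_lt_one hγ

/-- **THE SAME BY THE TWO-COMPONENT ROAD** [bookkeeping]: the windowed (5.10) letter at `(0, 1)` (stub 1's bill) and at `(0, 0)`, plus `PermCovariant` of the limiting kernels of
record on the record window (FILE 4 `kernelDecayOfRecord₁₃_all_of_offDiag_diag`). [folklore] -/
theorem decayBound_atPin_anyWindow_of_windowed_offDiag_diag_cov (hs : ℓ.Signs) (hL : PolLimitsExistOfRecord₁₃ F N θ) (h9 : WindowedNE9OfRecord₁₃ F N θ ℓ.κ ℓ.moduli)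
    (hW01 : WindowedDecayOfRecord₁₃ F N θ 0 1 ℓ.κ) (hW00 : WindowedDecayOfRecord₁₃ F N θ 0 0 ℓ.κ)
    (hcov : letI := θ.instVβ₁; letI := θ.instVβ₂; letI := θ.instιβ
      ∀ g ∈ Window θ.γ, ∀ k : ℕ, PermCovariant (kernelA F (mergedTermFamilyMatT F N (TβOfRecord₁₃ F N) (chiβOfRecord₁₃ F N θ) θ.εbg) θ.ρ8 θ.bV g k))
    {γ : ℝ} (hγ : γ ≤ θ.γ) :
    ∃ E₀ : ℝ, 0 ≤ E₀ ∧ DecayBound (u3OfRecord₁₃ θ (objectsOfRecord₁₃ F N θ ℓ) k).EA (Window γ) E₀ ℓ.κ :=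
  decayBound_atPin_anyWindow_of_kernelDecay_all_of_n22At θ ℓ k
    (kernelDecayOfRecord₁₃_all_of_offDiag_diag θ hcov (kernelDecayOfRecord₁₃_of_windowed F N θ 0 1 ℓ.κ hL hW01)
      (kernelDecayOfRecord₁₃_of_windowed F N θ 0 0 ℓ.κ hL hW00))
    (n22At_u3OfRecord₁₃_objectsOfRecord₁₃_of_windowed F N θ ℓ hs k hL h9) hs.C₉_nonneg hs.ω_nonneg hs.ω_lt_one hγ

end AtPin

/-! ## §2 Under the per-tuple pin at the reading: the consumers' `hdecT` text -/

section Pinned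

open scoped Matrix.Norms.L2Operator

variable (𝔯 : RateReading₁₃CoPH N) (G : ∀ {F : T4Family}, Stage13HParams F N → Prop) (ℓ : (F : T4Family) → Stage13HParams F N → U3Letters₁₁)
  (hpin : ∀ (F : T4Family) (θ : Stage13HParams F N) (hP : θ.Provisos₁₃CoPH F N) (g₀ : ℕ → ℝ) (os : List (ULoop F)),
    (𝔯.lit F θ hP g₀ os).u3 = objectsOfRecord₁₃ F N θ.toStage13Params (ℓ F θ))

include hpin

/-- ★★ **THE BUNDLE DECAY LETTER `hdecT` (VERBATIM text of dag-n19-w3's (8a)∕(8b), generic `N`, guard `G`) FROM THE (t-U3) PIN AND STUB 1's BILL ROWS** [bookkeeping]: `hs`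
(`(ℓ F θ).Signs`), `hL` (`PolLimitsExistOfRecord₁₃`), `h9` (`WindowedNE9OfRecord₁₃ … κ moduli`) and W1's windowed (5.10) letter AT EVERY PAIR (`hW 0 1` is the bill's `hW`). [folklore] -/
theorem hdecT_of_u3Pinned_of_stub1Rows
    (hs : ∀ (F : T4Family) (θ : Stage13HParams F N), θ.Provisos₁₃CoPH F N → G θ → θ.Admissible F N → (ℓ F θ).Signs)
    (hL : ∀ (F : T4Family) (θ : Stage13HParams F N), θ.Provisos₁₃CoPH F N → G θ → θ.Admissible F N → PolLimitsExistOfRecord₁₃ F N θ.toStage13Params)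
    (h9 : ∀ (F : T4Family) (θ : Stage13HParams F N), θ.Provisos₁₃CoPH F N → G θ → θ.Admissible F N →
      WindowedNE9OfRecord₁₃ F N θ.toStage13Params (ℓ F θ).κ (ℓ F θ).moduli)
    (hW : ∀ (μ ν : Fin 4) (F : T4Family) (θ : Stage13HParams F N), θ.Provisos₁₃CoPH F N → G θ → θ.Admissible F N →
      WindowedDecayOfRecord₁₃ F N θ.toStage13Params μ ν (ℓ F θ).κ) :
    ∀ (F : T4Family) (θ : Stage13HParams F N) (hP : θ.Provisos₁₃CoPH F N), G θ → θ.Admissible F N →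
      ∀ γ : ℝ, γ ≤ θ.γ → ∀ (g₀ : ℕ → ℝ) (os : List (ULoop F)) (k : ℕ), ∃ E₀ : ℝ, 0 ≤ E₀ ∧
        DecayBound (rateCarriersOfRecord₁₃CoPH 𝔯 F θ hP g₀ os k).u3.EA (Window γ) E₀ (rateCarriersOfRecord₁₃CoPH 𝔯 F θ hP g₀ os k).u3.κ := by
  intro F θ hP hG hθ γ hγ g₀ os k
  rw [u3_rateCarriersOfRecord₁₃CoPH_of_pin 𝔯 θ hP g₀ os (ℓ F θ) (hpin F θ hP g₀ os) k]
  exact decayBound_atPin_anyWindow_of_windowed_all _ (ℓ F θ) k (hs F θ hP hG hθ) (hL F θ hP hG hθ) (h9 F θ hP hG hθ) (fun μ ν => hW μ ν F θ hP hG hθ) hγ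

/-- ★ **`hdecT` BY THE TWO-COMPONENT ROAD** [bookkeeping]: the windowed (5.10) letter at `(0, 1)` (the bill's `hW`) and at `(0, 0)`, plus `PermCovariant` of the limiting kernels of record
at every guarded admissible tuple; `hs ∕ hL ∕ h9` as before. [folklore] -/
theorem hdecT_of_u3Pinned_of_stub1Rows_cov
    (hs : ∀ (F : T4Family) (θ : Stage13HParams F N), θ.Provisos₁₃CoPH F N → G θ → θ.Admissible F N → (ℓ F θ).Signs)
    (hL : ∀ (F : T4Family) (θ : Stage13HParams F N), θ.Provisos₁₃CoPH F N → G θ → θ.Admissible F N → PolLimitsExistOfRecord₁₃ F N θ.toStage13Params)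
    (h9 : ∀ (F : T4Family) (θ : Stage13HParams F N), θ.Provisos₁₃CoPH F N → G θ → θ.Admissible F N →
      WindowedNE9OfRecord₁₃ F N θ.toStage13Params (ℓ F θ).κ (ℓ F θ).moduli)
    (hW01 : ∀ (F : T4Family) (θ : Stage13HParams F N), θ.Provisos₁₃CoPH F N → G θ → θ.Admissible F N →
      WindowedDecayOfRecord₁₃ F N θ.toStage13Params 0 1 (ℓ F θ).κ)
    (hW00 : ∀ (F : T4Family) (θ : Stage13HParams F N), θ.Provisos₁₃CoPH F N → G θ → θ.Admissible F N →
      WindowedDecayOfRecord₁₃ F N θ.toStage13Params 0 0 (ℓ F θ).κ)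
    (hcov : ∀ (F : T4Family) (θ : Stage13HParams F N), θ.Provisos₁₃CoPH F N → G θ → θ.Admissible F N →
      letI := θ.instVβ₁; letI := θ.instVβ₂; letI := θ.instιβ
      ∀ g ∈ Window θ.γ, ∀ k : ℕ,
        PermCovariant (kernelA F (mergedTermFamilyMatT F N (TβOfRecord₁₃ F N) (chiβOfRecord₁₃ F N θ.toStage13Params) θ.εbg) θ.ρ8 θ.bV g k)) :
    ∀ (F : T4Family) (θ : Stage13HParams F N) (hP : θ.Provisos₁₃CoPH F N), G θ → θ.Admissible F N →
      ∀ γ : ℝ, γ ≤ θ.γ → ∀ (g₀ : ℕ → ℝ) (os : List (ULoop F)) (k : ℕ), ∃ E₀ : ℝ, 0 ≤ E₀ ∧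
        DecayBound (rateCarriersOfRecord₁₃CoPH 𝔯 F θ hP g₀ os k).u3.EA (Window γ) E₀ (rateCarriersOfRecord₁₃CoPH 𝔯 F θ hP g₀ os k).u3.κ := by
  intro F θ hP hG hθ γ hγ g₀ os k
  rw [u3_rateCarriersOfRecord₁₃CoPH_of_pin 𝔯 θ hP g₀ os (ℓ F θ) (hpin F θ hP g₀ os) k]
  exact decayBound_atPin_anyWindow_of_windowed_offDiag_diag_cov _ (ℓ F θ) k (hs F θ hP hG hθ) (hL F θ hP hG hθ) (h9 F θ hP hG hθ)
    (hW01 F θ hP hG hθ) (hW00 F θ hP hG hθ) (hcov F θ hP hG hθ) hγ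

/-- **CONVERSELY, `hdecT` RETURNS THE (D4)-TYPE LETTER AT EVERY PAIR** [bookkeeping]: at `γ := θ.γ` and any one `(g₀, os, k)` the clause is (T)'s decay on the record window at
the pinned bundle, whence `KernelDecayOfRecord₁₃ … μ ν (ℓ F θ).κ` for all `μ ν` (FILE 2 `kernelDecayOfRecord₁₃_of_decayBound`).  No positivity on `θ.γ` needed (an empty
window makes both sides vacuous). [folklore] -/
theorem kernelDecayOfRecord₁₃_all_of_hdecT_of_u3Pinned
    (hdecT : ∀ (F : T4Family) (θ : Stage13HParams F N) (hP : θ.Provisos₁₃CoPH F N), G θ → θ.Admissible F N →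
      ∀ γ : ℝ, γ ≤ θ.γ → ∀ (g₀ : ℕ → ℝ) (os : List (ULoop F)) (k : ℕ), ∃ E₀ : ℝ, 0 ≤ E₀ ∧
        DecayBound (rateCarriersOfRecord₁₃CoPH 𝔯 F θ hP g₀ os k).u3.EA (Window γ) E₀ (rateCarriersOfRecord₁₃CoPH 𝔯 F θ hP g₀ os k).u3.κ) :
    ∀ (F : T4Family) (θ : Stage13HParams F N), θ.Provisos₁₃CoPH F N → G θ → θ.Admissible F N →
      ∀ μ ν : Fin 4, KernelDecayOfRecord₁₃ F N θ.toStage13Params μ ν (ℓ F θ).κ := by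
  intro F θ hP hG hθ μ ν
  obtain ⟨E₀, -, hd⟩ := hdecT F θ hP hG hθ θ.γ le_rfl (fun _ => 0) [] 0
  rw [u3_rateCarriersOfRecord₁₃CoPH_of_pin 𝔯 θ hP (fun _ => 0) [] (ℓ F θ) (hpin F θ hP _ _) 0] at hd
  exact kernelDecayOfRecord₁₃_of_decayBound θ.toStage13Params (ℓ F θ) 0 hd μ ν

/-- ★ **UNDER THE (t-U3) PIN AND STUB 1's ROWS `hs ∕ hL ∕ h9`: `hdecT` ⟺ THE (D4)-TYPE LETTER `KernelDecayOfRecord₁₃ … μ ν (ℓ F θ).κ` AT EVERY PAIR AND EVERY GUARDED ADMISSIBLE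
TUPLE** [bookkeeping] (⟸ by §1 with the letter in place of its windowed producer). [folklore] -/
theorem hdecT_iff_kernelDecayOfRecord₁₃_all_of_u3Pinned
    (hs : ∀ (F : T4Family) (θ : Stage13HParams F N), θ.Provisos₁₃CoPH F N → G θ → θ.Admissible F N → (ℓ F θ).Signs)
    (hL : ∀ (F : T4Family) (θ : Stage13HParams F N), θ.Provisos₁₃CoPH F N → G θ → θ.Admissible F N → PolLimitsExistOfRecord₁₃ F N θ.toStage13Params)
    (h9 : ∀ (F : T4Family) (θ : Stage13HParams F N), θ.Provisos₁₃CoPH F N → G θ → θ.Admissible F N →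
      WindowedNE9OfRecord₁₃ F N θ.toStage13Params (ℓ F θ).κ (ℓ F θ).moduli) :
    (∀ (F : T4Family) (θ : Stage13HParams F N) (hP : θ.Provisos₁₃CoPH F N), G θ → θ.Admissible F N →
      ∀ γ : ℝ, γ ≤ θ.γ → ∀ (g₀ : ℕ → ℝ) (os : List (ULoop F)) (k : ℕ), ∃ E₀ : ℝ, 0 ≤ E₀ ∧
        DecayBound (rateCarriersOfRecord₁₃CoPH 𝔯 F θ hP g₀ os k).u3.EA (Window γ) E₀ (rateCarriersOfRecord₁₃CoPH 𝔯 F θ hP g₀ os k).u3.κ) ↔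
    (∀ (F : T4Family) (θ : Stage13HParams F N), θ.Provisos₁₃CoPH F N → G θ → θ.Admissible F N →
      ∀ μ ν : Fin 4, KernelDecayOfRecord₁₃ F N θ.toStage13Params μ ν (ℓ F θ).κ) := by
  refine ⟨kernelDecayOfRecord₁₃_all_of_hdecT_of_u3Pinned 𝔯 G ℓ hpin, fun h F θ hP hG hθ γ hγ g₀ os k => ?_⟩
  rw [u3_rateCarriersOfRecord₁₃CoPH_of_pin 𝔯 θ hP g₀ os (ℓ F θ) (hpin F θ hP g₀ os) k]
  exact decayBound_atPin_anyWindow_of_kernelDecay_all_of_n22At _ (ℓ F θ) k (h F θ hP hG hθ)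
    (n22At_u3OfRecord₁₃_objectsOfRecord₁₃_of_windowed F N θ.toStage13Params (ℓ F θ) (hs F θ hP hG hθ) k (hL F θ hP hG hθ) (h9 F θ hP hG hθ))
    (hs F θ hP hG hθ).C₉_nonneg (hs F θ hP hG hθ).ω_nonneg (hs F θ hP hG hθ).ω_lt_one hγ

end Pinned

end Summit.QuantumFields.YangMills.BalabanUVNodes.N19BundleDecayLetterFromStub1Rows

end
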